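import Summits.CriticalPhenomena.SAWScalingLimit.Theses.SAWDevelopingMap
import Summits.CriticalPhenomena.SAWScalingLimit.Theses.SAWPhaseRetrieval
import Summits.CriticalPhenomena.SAWScalingLimit.Theses.SAWCompassLattice
import Summits.CriticalPhenomena.SAWScalingLimit.Theses.SAWBrickWallHomotopy
import Summits.CriticalPhenomena.SAWScalingLimit.Theorems.SAWDevelopingMapHexTransferCompassRealisation
import Summits.CriticalPhenomena.SAWScalingLimit.Theorems.SAWDevelopingMapHexTransferCompassEndpoints
import Summits.CriticalPhenomena.SAWScalingLimit.Theorems.SAWDevelopingMapHexTransferPortDictionary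
import Summits.CriticalPhenomena.SAWScalingLimit.Theorems.SAWDevelopingMapHexTransferPortTransfer
import Summits.CriticalPhenomena.SAWScalingLimit.Theorems.SAWDevelopingMapHexTransferQuarterTurnCovariance
import Summits.CriticalPhenomena.SAWScalingLimit.Theorems.SAWDevelopingMapHexTransferLinearPinning
import Summits.CriticalPhenomena.SAWScalingLimit.Theorems.SAWDevelopingMapHexTransferConjugateRotationCovariance
import Summits.CriticalPhenomena.SAWScalingLimit.Theorems.SAWDevelopingMapHexTransferSimilarityIdentification
import Summits.CriticalPhenomena.SAWScalingLimit.Theorems.SAWDefectDecoherenceHexTransferStretchRigidity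
import Literature.Probability.RandomPlanarGeometry.LocalMartingaleProofs

/-!
# Line `pin-the-shear` for the crux `HexTransfer` — the reduction that is left (cycle 2)

Crux `stmt-CriticalPhenomena-14221`:
`HexTransfer := (Duminil-Copin–Smirnov 2012 Conjecture 1, written out) → SAWScalingLimit`
(`Theses.SAWPhaseRetrieval.HexTransfer`; identical bodies in `SAWDevelopingMap`, `SAWWindingAlias`,
`SAWDefectDecoherence`).

The line transports the hexagonal hypothesis to `δℤ²` modulo ONE unidentified linear map
`Φ ∈ GL₂⁺(ℝ)` and pins `Φ` a posteriori. Five of its seven registered stubs are theorems of the tree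
by now: `stub_quarterTurnCovariance` (item 5794), `stub_stretchRigidity` (item 5793: chordal SLE(8/3)
has no axis-stretch covariance), `stub_linearPinning`, `stub_conjugateRotationCovariance`,
`stub_similarityIdentification`. What remains are the two statements of open-problem size, kept
here as HYPOTHESES (nothing is assumed about the crux): the Yang–Baxter shear transport
(law-level transport of the critical hexagonal SAW law to Glazman–Manolescu's `Θ ≡ π/2` walk, modulo
an unidentified `Φ`) and `SurfaceUniversality` (item stmt-CriticalPhenomena-6964). This file records,
sorry-free, that they suffice: `stub_pinLineReduction`.

Contents: the existence of the linear homeomorphism of a non-singular 2×2 matrix and the formula of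
the conjugated quarter-turn `Φ⁻¹ R Φ` (`exists_linear_homeomorph`, `conjRot_formula_of`), its
determinant (`conjRot_det`), the 2×2 pin (`entries_of_conj_pinned`), the transport chain
`imageLimit_of_transport` ((A) + shear transport + the landed port machinery of line `Sketch` +
surface universality ⟹ the `δℤ²` law converges to `Φ ∘ SLE(8/3)`), and the reduction.
-/

noncomputable section

namespace Summit.CriticalPhenomena.SAWScalingLimit.Cruxes.HexTransfer.PinTheShear

open MeasureTheory Filter Topology Set
open scoped NNReal ENNReal
open Literature.Probability.RandomPlanarGeometry
open Literature.Probability.RandomPlanarGeometry.SAW.YangBaxter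
open Literature.Probability.LatticeModels (Site HexVertex hexGraph hexCenter)
open Literature.Probability (Process.preWienerMeasure)
open Summit.CriticalPhenomena.SAWScalingLimit.Theses
open Summit.CriticalPhenomena.SAWScalingLimit.Cruxes.HexTransfer.Sketch
open Summit.CriticalPhenomena.SAWScalingLimit.Cruxes.HexTransfer.Sketch.PortTransfer

/-! ### Linear homeomorphisms of the plane and the conjugated quarter-turn -/

/-- **The linear homeomorphism** of the plane with matrix `M = (m₁₁ m₁₂; m₂₁ m₂₂)` of non-zero
determinant `d` exists, with inverse the linear map of `M⁻¹ = d⁻¹ (m₂₂ -m₁₂; -m₂₁ m₁₁)`.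
[folklore] -/
theorem exists_linear_homeomorph {m₁₁ m₁₂ m₂₁ m₂₂ : ℝ} (hd : m₁₁ * m₂₂ - m₁₂ * m₂₁ ≠ 0) :
    ∃ Φ : ℂ ≃ₜ ℂ,
      (∀ z : ℂ, Φ z = ((m₁₁ * z.re + m₁₂ * z.im : ℝ) : ℂ) +
        ((m₂₁ * z.re + m₂₂ * z.im : ℝ) : ℂ) * Complex.I) ∧
      ∀ z : ℂ, Φ.symm z =
        ((m₂₂ / (m₁₁ * m₂₂ - m₁₂ * m₂₁) * z.re + -m₁₂ / (m₁₁ * m₂₂ - m₁₂ * m₂₁) * z.im : ℝ) : ℂ) +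
        ((-m₂₁ / (m₁₁ * m₂₂ - m₁₂ * m₂₁) * z.re + m₁₁ / (m₁₁ * m₂₂ - m₁₂ * m₂₁) * z.im : ℝ) : ℂ) *
          Complex.I := by
  refine ⟨{ toFun := fun z => ((m₁₁ * z.re + m₁₂ * z.im : ℝ) : ℂ) +
              ((m₂₁ * z.re + m₂₂ * z.im : ℝ) : ℂ) * Complex.I
            invFun := fun z =>
              ((m₂₂ / (m₁₁ * m₂₂ - m₁₂ * m₂₁) * z.re + -m₁₂ / (m₁₁ * m₂₂ - m₁₂ * m₂₁) * z.im : ℝ) : ℂ) +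
              ((-m₂₁ / (m₁₁ * m₂₂ - m₁₂ * m₂₁) * z.re + m₁₁ / (m₁₁ * m₂₂ - m₁₂ * m₂₁) * z.im : ℝ) : ℂ) *
                Complex.I
            left_inv := fun z => ?_
            right_inv := fun z => ?_
            continuous_toFun := by fun_prop
            continuous_invFun := by fun_prop }, fun z => rfl, fun z => rfl⟩
  · apply Complex.ext
    · simp only [Complex.add_re, Complex.ofReal_re, Complex.mul_re, Complex.I_re, Complex.I_im,
        Complex.ofReal_im, Complex.add_im, Complex.mul_im, div_eq_mul_inv]
      linear_combination z.re * mul_inv_cancel₀ hd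
    · simp only [Complex.add_re, Complex.ofReal_re, Complex.mul_re, Complex.I_re, Complex.I_im,
        Complex.ofReal_im, Complex.add_im, Complex.mul_im, div_eq_mul_inv]
      linear_combination z.im * mul_inv_cancel₀ hd
  · apply Complex.ext
    · simp only [Complex.add_re, Complex.ofReal_re, Complex.mul_re, Complex.I_re, Complex.I_im,
        Complex.ofReal_im, Complex.add_im, Complex.mul_im, div_eq_mul_inv]
      linear_combination z.re * mul_inv_cancel₀ hd
    · simp only [Complex.add_re, Complex.ofReal_re, Complex.mul_re, Complex.I_re, Complex.I_im,
        Complex.ofReal_im, Complex.add_im, Complex.mul_im, div_eq_mul_inv]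
      linear_combination z.im * mul_inv_cancel₀ hd

/-- **The conjugated quarter-turn is linear**, with matrix `M⁻¹ R M` (`R = (0 -1; 1 0)`), for any
homeomorphism acting as `M` with inverse acting as `M⁻¹`. [folklore] -/
theorem conjRot_formula_of {m₁₁ m₁₂ m₂₁ m₂₂ : ℝ} {Φ : ℂ ≃ₜ ℂ}
    (hΦ : ∀ z : ℂ, Φ z = ((m₁₁ * z.re + m₁₂ * z.im : ℝ) : ℂ) +
      ((m₂₁ * z.re + m₂₂ * z.im : ℝ) : ℂ) * Complex.I)
    (hΦ' : ∀ z : ℂ, Φ.symm z =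
      ((m₂₂ / (m₁₁ * m₂₂ - m₁₂ * m₂₁) * z.re + -m₁₂ / (m₁₁ * m₂₂ - m₁₂ * m₂₁) * z.im : ℝ) : ℂ) +
      ((-m₂₁ / (m₁₁ * m₂₂ - m₁₂ * m₂₁) * z.re + m₁₁ / (m₁₁ * m₂₂ - m₁₂ * m₂₁) * z.im : ℝ) : ℂ) *
        Complex.I) (z : ℂ) :
    (Φ.trans ((similarity Complex.I Complex.I_ne_zero 0).trans Φ.symm)) z =
      ((-(m₁₁ * m₁₂ + m₂₁ * m₂₂) / (m₁₁ * m₂₂ - m₁₂ * m₂₁) * z.re +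
          -(m₁₂ ^ 2 + m₂₂ ^ 2) / (m₁₁ * m₂₂ - m₁₂ * m₂₁) * z.im : ℝ) : ℂ) +
        (((m₁₁ ^ 2 + m₂₁ ^ 2) / (m₁₁ * m₂₂ - m₁₂ * m₂₁) * z.re +
          (m₁₁ * m₁₂ + m₂₁ * m₂₂) / (m₁₁ * m₂₂ - m₁₂ * m₂₁) * z.im : ℝ) : ℂ) * Complex.I := by
  rw [Homeomorph.trans_apply, Homeomorph.trans_apply, similarity_apply, add_zero, hΦ', hΦ]
  apply Complex.ext
  · simp only [Complex.add_re, Complex.ofReal_re, Complex.mul_re, Complex.I_re, Complex.I_im,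
      Complex.ofReal_im, Complex.add_im, Complex.mul_im, div_eq_mul_inv]
    ring
  · simp only [Complex.add_re, Complex.ofReal_re, Complex.mul_re, Complex.I_re, Complex.I_im,
      Complex.ofReal_im, Complex.add_im, Complex.mul_im, div_eq_mul_inv]
    ring

/-- The conjugated quarter-turn has determinant `1` (Lagrange's identity). [folklore] -/
theorem conjRot_det {m₁₁ m₁₂ m₂₁ m₂₂ : ℝ} (hd : m₁₁ * m₂₂ - m₁₂ * m₂₁ ≠ 0) :
    (-(m₁₁ * m₁₂ + m₂₁ * m₂₂) / (m₁₁ * m₂₂ - m₁₂ * m₂₁)) *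
        ((m₁₁ * m₁₂ + m₂₁ * m₂₂) / (m₁₁ * m₂₂ - m₁₂ * m₂₁)) -
      (-(m₁₂ ^ 2 + m₂₂ ^ 2) / (m₁₁ * m₂₂ - m₁₂ * m₂₁)) *
        ((m₁₁ ^ 2 + m₂₁ ^ 2) / (m₁₁ * m₂₂ - m₁₂ * m₂₁)) = 1 := by
  field_simp
  ring

/-- **The pin's last step (2×2 algebra).** If `det M > 0` and the conjugate `M⁻¹ R M` of the
quarter-turn is a rotation-dilation (`ψ₁₁ = ψ₂₂`, `ψ₁₂ = -ψ₂₁`), then the columns of `M` are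
orthogonal of equal length and positively oriented: `M` is the rotation-dilation
`z ↦ (m₁₁ + i m₂₁) z`. (The case `M⁻¹RM = R⁻¹` is excluded by `det M > 0` automatically:
`ψ₂₁ = (m₁₁² + m₂₁²)/det M > 0`.) [folklore] -/
theorem entries_of_conj_pinned {m₁₁ m₁₂ m₂₁ m₂₂ : ℝ} (hd : 0 < m₁₁ * m₂₂ - m₁₂ * m₂₁)
    (h₁ : -(m₁₁ * m₁₂ + m₂₁ * m₂₂) / (m₁₁ * m₂₂ - m₁₂ * m₂₁) =
      (m₁₁ * m₁₂ + m₂₁ * m₂₂) / (m₁₁ * m₂₂ - m₁₂ * m₂₁))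
    (h₂ : -(m₁₂ ^ 2 + m₂₂ ^ 2) / (m₁₁ * m₂₂ - m₁₂ * m₂₁) =
      -((m₁₁ ^ 2 + m₂₁ ^ 2) / (m₁₁ * m₂₂ - m₁₂ * m₂₁))) :
    m₁₂ = -m₂₁ ∧ m₂₂ = m₁₁ := by
  have hd0 : m₁₁ * m₂₂ - m₁₂ * m₂₁ ≠ 0 := hd.ne'
  -- orthogonal columns
  rw [div_eq_div_iff hd0 hd0] at h₁
  have hp : (m₁₁ * m₁₂ + m₂₁ * m₂₂) * (m₁₁ * m₂₂ - m₁₂ * m₂₁) = 0 := by linarith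
  have hp' : m₁₁ * m₁₂ + m₂₁ * m₂₂ = 0 := by
    rcases mul_eq_zero.1 hp with h | h
    · exact h
    · exact absurd h hd0
  -- columns of equal length
  rw [neg_div, neg_inj, div_left_inj' hd0] at h₂
  -- Lagrange: det² = |c₁|²|c₂|² - (c₁·c₂)² = |c₁|⁴, so det = |c₁|²
  have hL : (m₁₁ * m₂₂ - m₁₂ * m₂₁) ^ 2 = (m₁₁ ^ 2 + m₂₁ ^ 2) ^ 2 := by
    have : (m₁₁ * m₂₂ - m₁₂ * m₂₁) ^ 2 =
        (m₁₁ ^ 2 + m₂₁ ^ 2) * (m₁₂ ^ 2 + m₂₂ ^ 2) - (m₁₁ * m₁₂ + m₂₁ * m₂₂) ^ 2 := by ring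
    rw [this, hp', h₂]
    ring
  have hdn : m₁₁ * m₂₂ - m₁₂ * m₂₁ = m₁₁ ^ 2 + m₂₁ ^ 2 := by
    have hn : 0 ≤ m₁₁ ^ 2 + m₂₁ ^ 2 := by positivity
    nlinarith [hL, hd, hn]
  -- sum of two squares vanishes
  have hs : (m₁₂ + m₂₁) ^ 2 + (m₂₂ - m₁₁) ^ 2 = 0 := by nlinarith [h₂, hdn, hp']
  have h12 : (m₁₂ + m₂₁) ^ 2 = 0 := by nlinarith [sq_nonneg (m₁₂ + m₂₁), sq_nonneg (m₂₂ - m₁₁)]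
  have h22 : (m₂₂ - m₁₁) ^ 2 = 0 := by nlinarith [sq_nonneg (m₁₂ + m₂₁), sq_nonneg (m₂₂ - m₁₁)]
  have e1 : m₁₂ + m₂₁ = 0 := (pow_eq_zero_iff two_ne_zero).1 h12
  have e2 : m₂₂ - m₁₁ = 0 := (pow_eq_zero_iff two_ne_zero).1 h22
  exact ⟨by linarith, by linarith⟩

/-! ### The transport chain -/

/-- **Image limit from the transport chain** (sorry-free glue of the line). Fix a linear `Φ` for
which the YB shear transport holds. Then Duminil-Copin–Smirnov's Conjecture 1 (hypothesis `hA`,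
applied in `Φ⁻¹(D)`), the landed port machinery of line `Sketch` (compass endpoints, compass
realisation, port dictionary, the O(δ) coupling `dist_compassCurve_curve_le` and the
bounded-Lipschitz transfer `tendstoLaw_of_dist_le`) and surface universality (`hU`) show: for
every Dobrushin domain `D` and every `ℤ²` endpoint approximation, the critical `δℤ²` SAW law
converges in law to `Φ ∘ Γ` with `Γ` an SLE(8/3) random curve of `Φ⁻¹(D)`. [folklore] -/
theorem imageLimit_of_transport (hA : SAWDevelopingMap.HexConjecture)
    (hU : SAWCompassLattice.SurfaceUniversality) {Φ : ℂ ≃ₜ ℂ}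
    (hT : ∀ (D : DobrushinDomain) (a b : ℝ → MidEdge),
      IsYBEndpointApprox (fun (_ : ℤ) => Real.pi / 2) D a b →
      ∃ a' b' : ℝ → HexVertex,
        SAW.IsEmbEndpointApprox hexGraph hexCenter (D.map Φ.symm) a' b' ∧
        ∀ f : BoundedContinuousFunction (CurveClass ℂ) ℝ,
          Tendsto (fun δ => (∫ γ, f (γ.curve (fun (_ : ℤ) => Real.pi / 2) δ)
              ∂(ybLaw (fun (_ : ℤ) => Real.pi / 2) D.carrier δ 1 (a δ) (b δ))) -
            ∫ γ, f (CurveClass.map (Φ : C(ℂ, ℂ)) γ.curve)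
              ∂(SAW.hexSAWLaw (D.map Φ.symm).carrier δ (a' δ) (b' δ)))
            (𝓝[>] 0) (𝓝 0)) :
    ∀ (D : DobrushinDomain) (a b : ℝ → Site 2), SAW.IsEndpointApprox D a b →
      ∃ Γ : (ℝ≥0 → ℝ) → CurveClass ℂ, IsSLECurve ((8 : ℝ≥0) / 3) (D.map Φ.symm) Γ ∧
        TendstoLaw (fun δ (γ : SAW.DomainSAW D.carrier δ (a δ) (b δ)) => γ.curve)
          (fun δ => SAW.law D.carrier δ (a δ) (b δ))
          (fun ω => CurveClass.map (Φ : C(ℂ, ℂ)) (Γ ω)) Process.preWienerMeasure := by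
  intro D a b hab
  -- ports of `D` (landed `stub_compassEndpoints`), hexagonal endpoints of `Φ⁻¹ D` (transport),
  -- and the SLE(8/3) curve of `Φ⁻¹ D` given by (A)
  obtain ⟨a', b', hab'⟩ := stub_compassEndpoints D
  obtain ⟨a'', b'', hab'', hdiff⟩ := hT D a' b' hab'
  obtain ⟨Γ, hΓ, -, hH⟩ := hA (D.map Φ.symm) a'' b'' hab''
  refine ⟨Γ, hΓ, ?_⟩
  haveI := isProbabilityMeasure_preWienerMeasure'
  have hΦc : Continuous (CurveClass.map (Φ : C(ℂ, ℂ))) := CurveClass.continuous_map _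
  set g : C(CurveClass ℂ, CurveClass ℂ) := ⟨CurveClass.map (Φ : C(ℂ, ℂ)), hΦc⟩ with hg
  have hZ : AEMeasurable (fun ω => CurveClass.map (Φ : C(ℂ, ℂ)) (Γ ω)) Process.preWienerMeasure :=
    hΦc.measurable.comp_aemeasurable hΓ.aemeasurable
  -- Step 1: GM's `π/2` law from the ports converges in law to `Φ ∘ Γ`
  have h1 : TendstoLaw
      (fun δ (γ : YangBaxterSAW (fun (_ : ℤ) => Real.pi / 2) D.carrier δ (a' δ) (b' δ)) =>
        γ.curve (fun (_ : ℤ) => Real.pi / 2) δ)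
      (fun δ => ybLaw (fun (_ : ℤ) => Real.pi / 2) D.carrier δ 1 (a' δ) (b' δ))
      (fun ω => CurveClass.map (Φ : C(ℂ, ℂ)) (Γ ω)) Process.preWienerMeasure := by
    intro f
    have hf := hH (f.compContinuous g)
    have h := (hdiff f).add hf
    rw [zero_add] at h
    refine (h.congr fun δ => ?_).congr' (Eventually.of_forall fun δ => rfl)
    simp only [BoundedContinuousFunction.compContinuous_apply, hg, ContinuousMap.coe_mk]
    ring
  -- Step 2: the compass law from the same ports converges in law to `Φ ∘ Γ` (port transfer)
  obtain ⟨α, β, s, z, hsol⟩ := stub_compassRealisation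
  have hP : SAWCompassLattice.PortDictionary := stub_portDictionary
  have h2 : TendstoLaw (fun (_ : ℝ) (x : CurveClass ℂ) => x)
      (fun δ => compassLaw α β s z D.carrier δ (a' δ) (b' δ))
      (fun ω => CurveClass.map (Φ : C(ℂ, ℂ)) (Γ ω)) Process.preWienerMeasure := by
    have hT' : TendstoLaw
        (fun δ (p : CPath D.carrier δ (a' δ) (b' δ)) =>
          (toYB hP hsol p).curve (fun (_ : ℤ) => Real.pi / 2) δ)
        (fun δ => compassRho α β s z D.carrier δ (a' δ) (b' δ))
        (fun ω => CurveClass.map (Φ : C(ℂ, ℂ)) (Γ ω)) Process.preWienerMeasure := by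
      intro f
      refine (h1 f).congr fun δ => ?_
      change ∫ γ, f (γ.curve (fun (_ : ℤ) => Real.pi / 2) δ)
          ∂(ybLaw (fun (_ : ℤ) => Real.pi / 2) D.carrier δ 1 (a' δ) (b' δ)) = _
      rw [ybLaw_eq_map hP hsol, integral_map (measurable_cpath _).aemeasurable]
      exact (YBWalk.measurable_of_top _).aestronglyMeasurable
    have hε : Tendsto (fun δ : ℝ => |δ|) (𝓝[>] 0) (𝓝 0) :=
      (continuous_abs.tendsto' (0 : ℝ) 0 abs_zero).mono_left nhdsWithin_le_nhds
    have hT'' := tendstoLaw_of_dist_le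
      (Y := fun δ (p : CPath D.carrier δ (a' δ) (b' δ)) => compassCurve δ p)
      (fun δ => compassRho_zero_or_prob α β s z D.carrier δ (a' δ) (b' δ))
      (fun δ => (measurable_cpath _).aemeasurable) (fun δ => (measurable_cpath _).aemeasurable)
      hZ hε (fun δ p => dist_compassCurve_curve_le p _ (toYB_mids hP hsol p)) hT'
    intro f
    refine (hT'' f).congr fun δ => ?_
    change _ = ∫ x, f x ∂(compassLaw α β s z D.carrier δ (a' δ) (b' δ))
    rw [compassLaw_eq_map, integral_map (measurable_cpath _).aemeasurable
      f.continuous.aestronglyMeasurable]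
  -- Step 3: surface universality moves the limit to the uniform `δℤ²` law (two-ε)
  intro f
  have h3 : Tendsto (fun δ => (∫ γ, f γ.curve ∂(SAW.law D.carrier δ (a δ) (b δ))) -
      ∫ x, f x ∂(compassLaw α β s z D.carrier δ (a' δ) (b' δ))) (𝓝[>] 0) (𝓝 0) :=
    hU α β s z hsol D a b a' b' hab hab' f
  have h := h3.add (h2 f)
  rw [zero_add] at h
  exact h.congr fun δ => sub_add_cancel _ _

/-! ### The line closes the crux modulo its two open stubs -/

/-- **What the line `pin-the-shear` leaves of the crux `HexTransfer` (stmt-CriticalPhenomena-14221).**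
If the Yang–Baxter shear transport holds (the line\'s `stub_ybShearTransport`: under (A), the critical
`π/2` Glazman–Manolescu law of `D` and the `Φ`-image of the critical hexagonal law of `Φ⁻¹ D` are
asymptotically equal for ONE unidentified linear `Φ` of positive determinant) and surface
universality holds (`SurfaceUniversality`, item stmt-6964), then `HexTransfer`. Proof: take the
matrix `M` of the transport and its linear homeomorphism `Φ₀`; the transport chain gives the image
limit of `Φ₀`; the conjugated quarter-turn `Φ₀⁻¹ R Φ₀` is then a covariance of the SLE(8/3) family
(`stub_conjugateRotationCovariance`, `stub_quarterTurnCovariance`), linear of determinant `1`,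
hence a rotation-dilation (`stub_linearPinning`, `stub_stretchRigidity`), hence `M` is the
similarity `m₁₁ + i m₂₁` (`entries_of_conj_pinned`), and `stub_similarityIdentification` ends.
[folklore] -/
theorem stub_pinLineReduction :
    (SAWDevelopingMap.HexConjecture → ∃ m₁₁ m₁₂ m₂₁ m₂₂ : ℝ, 0 < m₁₁ * m₂₂ - m₁₂ * m₂₁ ∧ ∀ Φ : ℂ ≃ₜ ℂ, (∀ z : ℂ, Φ z = ((m₁₁ * z.re + m₁₂ * z.im : ℝ) : ℂ) + ((m₂₁ * z.re + m₂₂ * z.im : ℝ) : ℂ) * Complex.I) → ∀ (D : DobrushinDomain) (a b : ℝ → MidEdge), IsYBEndpointApprox (fun (_ : ℤ) => Real.pi / 2) D a b → ∃ a' b' : ℝ → HexVertex, SAW.IsEmbEndpointApprox hexGraph hexCenter (D.map Φ.symm) a' b' ∧ ∀ f : BoundedContinuousFunction (CurveClass ℂ) ℝ, Tendsto (fun δ => (∫ γ, f (γ.curve (fun (_ : ℤ) => Real.pi / 2) δ) ∂(ybLaw (fun (_ : ℤ) => Real.pi / 2) D.carrier δ 1 (a δ) (b δ))) - ∫ γ,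 f (CurveClass.map (Φ : C(ℂ, ℂ)) γ.curve) ∂(SAW.hexSAWLaw (D.map Φ.symm).carrier δ (a' δ) (b' δ))) (𝓝[>] 0) (𝓝 0)) → SAWCompassLattice.SurfaceUniversality → SAWPhaseRetrieval.HexTransfer := by
  intro hYB hU hA
  obtain ⟨m₁₁, m₁₂, m₂₁, m₂₂, hdet, hT⟩ := hYB hA
  have hd0 : m₁₁ * m₂₂ - m₁₂ * m₂₁ ≠ 0 := hdet.ne'
  obtain ⟨Φ₀, hΦ₀, hΦ₀'⟩ := exists_linear_homeomorph hd0
  -- the image limit of `Φ₀`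
  have hIL₀ := imageLimit_of_transport hA hU (hT Φ₀ hΦ₀)
  -- `Ψ₀ = Φ₀⁻¹ R Φ₀` is a covariance of the SLE(8/3) family, linear of determinant 1
  have hcov := stub_conjugateRotationCovariance Φ₀ hIL₀ stub_quarterTurnCovariance
  have hψdet : 0 < (-(m₁₁ * m₁₂ + m₂₁ * m₂₂) / (m₁₁ * m₂₂ - m₁₂ * m₂₁)) *
        ((m₁₁ * m₁₂ + m₂₁ * m₂₂) / (m₁₁ * m₂₂ - m₁₂ * m₂₁)) -
      (-(m₁₂ ^ 2 + m₂₂ ^ 2) / (m₁₁ * m₂₂ - m₁₂ * m₂₁)) *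
        ((m₁₁ ^ 2 + m₂₁ ^ 2) / (m₁₁ * m₂₂ - m₁₂ * m₂₁)) := by
    rw [conjRot_det hd0]
    exact one_pos
  -- so `Ψ₀` is a rotation-dilation and `M` a similarity
  have hpin := stub_linearPinning stub_stretchRigidity _ _ _ _ hψdet _
    (conjRot_formula_of hΦ₀ hΦ₀') hcov
  obtain ⟨h12, h22⟩ := entries_of_conj_pinned hdet hpin.1 hpin.2
  have hc : (⟨m₁₁, m₂₁⟩ : ℂ) ≠ 0 := by
    intro h
    have h1 : m₁₁ = 0 := by simpa using congrArg Complex.re h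
    have h2 : m₂₁ = 0 := by simpa using congrArg Complex.im h
    rw [h1, h2] at hdet
    simp at hdet
  refine stub_similarityIdentification ⟨m₁₁, m₂₁⟩ hc
    (imageLimit_of_transport hA hU (hT _ fun z => ?_))
  rw [similarity_apply, add_zero, h12, h22]
  apply Complex.ext <;> simp <;> ring

/-- The reduction against route `SAWDevelopingMap`\'s copy of the crux (identical body). [folklore] -/
theorem pinLineReduction_developingMap :
    (SAWDevelopingMap.HexConjecture → ∃ m₁₁ m₁₂ m₂₁ m₂₂ : ℝ, 0 < m₁₁ * m₂₂ - m₁₂ * m₂₁ ∧ ∀ Φ : ℂ ≃ₜ ℂ, (∀ z : ℂ, Φ z = ((m₁₁ * z.re + m₁₂ * z.im : ℝ) : ℂ) + ((m₂₁ * z.re + m₂₂ * z.im : ℝ) : ℂ) * Complex.I) → ∀ (D : DobrushinDomain) (a b : ℝ → MidEdge), IsYBEndpointApprox (fun (_ : ℤ) => Real.pi / 2) D a b → ∃ a' b' : ℝ → HexVertex, SAW.IsEmbEndpointApprox hexGraph hexCenter (D.map Φ.symm) a' b' ∧ ∀ f : BoundedContinuousFunction (CurveClass ℂ) ℝ, Tendsto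 (fun δ => (∫ γ, f (γ.curve (fun (_ : ℤ) => Real.pi / 2) δ) ∂(ybLaw (fun (_ : ℤ) => Real.pi / 2) D.carrier δ 1 (a δ) (b δ))) - ∫ γ, f (CurveClass.map (Φ : C(ℂ, ℂ)) γ.curve) ∂(SAW.hexSAWLaw (D.map Φ.symm).carrier δ (a' δ) (b' δ))) (𝓝[>] 0) (𝓝 0)) → SAWCompassLattice.SurfaceUniversality → SAWDevelopingMap.HexTransfer :=
  stub_pinLineReduction

end Summit.CriticalPhenomena.SAWScalingLimit.Cruxes.HexTransfer.PinTheShear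

end
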